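import Literature.AnabelianGeometry.AbsoluteAnabelian.MLFGaloisElasticProofs
import Literature.AnabelianGeometry.AbsoluteAnabelian.NFGaloisTFGNormalProofs
import Literature.AnabelianGeometry.AbsoluteAnabelian.NFSlimKummerProofs
import HarnessLib

/-!
# [AbsTopI] Thm 1.7 (ii), (iii): slimness and elasticity of arithmetic Galois groups — assembly

S. Mochizuki, *Topics in Absolute Anabelian Geometry I: Generalities* (2012) [AbsTopI] (lit key
`paper:url-11ac98ba15fc`), Thm 1.7 p. 14: "(ii) If `k` is an MLF of residue characteristic `p`,
then `G_k`, as well as any almost pro-`p`-maximal quotient `G_k ↠ Q` of `G_k`, is elastic and slim.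
(iii) If `k` is an NF, then `G_k` is very elastic and slim."  (Def 1.1 (ii) p. 10: *elastic* = every
topologically finitely generated closed normal subgroup of an open subgroup is trivial or of finite
index; *very elastic* = elastic but not topologically finitely generated.)

THIS PROOF-ONLY FILE (no definitions, no named facts) assembles the kernel theorems of the abc-iut
cell into the printed statements, case `k̃ = k̄` (absolute Galois groups):

* `isElastic_absoluteGaloisGroup_numberField` — `G_F` is ELASTIC for a number field `F`; indeed
  every topologically finitely generated closed normal subgroup of an OPEN subgroup `H ⊆ G_F` is
  already trivial: `H = G_E` for a finite extension `E/F` (infinite Galois theory,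
  `GaloisSubextensionProofs`), and [AbsAnab] Thm 1.1.2 for the number field `E`
  (`galoisNF_tfgNormalSubgroup_trivial_holds`, abc-iut-L4-d2's elementary square-class proof);
* `isVeryElastic_absoluteGaloisGroup_numberField` — with abc-iut-L4-t8's
  `not_isTopologicallyFinitelyGenerated_absoluteGaloisGroup`;
* `thm17iii` — **Thm 1.7 (iii)**: `G_F` is very elastic and slim (`galoisNF_slim_holds`);
* `thm17ii` — **Thm 1.7 (ii) for `G_k` itself**: `G_k` (`k/ℚ_p` finite) is elastic
  (`isElastic_absoluteGaloisGroup`, GAP row G-w5d206-1) and slim (`galoisMLF_slim_holds`).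

HONEST SCOPE: NOT addressed here — (ii)'s clause on the almost pro-`p`-maximal QUOTIENTS
`G_k ↠ Q`, and (i) (`k` a finite field: `G_k ≅ Ẑ` is neither elastic nor slim).  The elasticity of
`G_k` (MLF) rests on the cell's elementary rank route, not the printed free-pro-`p` route.  Classical;
nothing here bears on [IUTchIII] Cor. 3.12.
-/

noncomputable section

open Field


namespace Literature.AnabelianGeometry.AbsoluteAnabelian

open Literature.AlgebraicGeometry.Frobenioids (IsSlimGroup)

/-- **`G_F` is elastic** for a number field `F` — in the strong form that every topologically
finitely generated closed normal subgroup `N` of an open subgroup `H ⊆ G_F` is TRIVIAL: `H = G_E`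
for the finite extension `E = F̄^H`, and [AbsAnab] Thm 1.1.2 applies to the number field `E`.
[cite: MochizukiAbsTopI2012, Thm 1.7 (iii) p.14] -/
theorem eq_bot_of_tfg_normal_of_isOpen_absoluteGaloisGroup_numberField (F : Type) [Field F]
    [NumberField F] (H N : Subgroup (absoluteGaloisGroup F))
    (hHo : IsOpen (H : Set (absoluteGaloisGroup F))) (hNH : N ≤ H) (hNn : (N.subgroupOf H).Normal)
    (hNc : IsClosed (N : Set (absoluteGaloisGroup F))) (hNfg : IsTopologicallyFinitelyGenerated N) :
    N = ⊥ := by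
  classical
  -- `H = G_E` for a finite subextension `E`, a number field
  obtain ⟨E, hEfin, -, hEH⟩ := exists_intermediateField_of_isOpen_absoluteGaloisGroup F H hHo
  haveI := hEfin
  haveI : NumberField E := NumberField.of_module_finite F E
  obtain ⟨e⟩ := nonempty_continuousMulEquiv_fixingSubgroup F E
  rw [hEH] at e
  -- push `N ∩ H = N` (as a subgroup of `H`) forward to `G_E`
  let N' : Subgroup (absoluteGaloisGroup E) := (N.subgroupOf H).map e.toMonoidHom
  have hmemN' : ∀ y, y ∈ N' ↔ ((e.symm y : H) : absoluteGaloisGroup F) ∈ N := by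
    intro y
    constructor
    · rintro ⟨x, hx, rfl⟩
      have hx' : (x : absoluteGaloisGroup F) ∈ N := Subgroup.mem_subgroupOf.mp hx
      change ((e.symm (e x) : H) : absoluteGaloisGroup F) ∈ N
      rw [e.symm_apply_apply]
      exact hx'
    · intro hy
      exact ⟨e.symm y, Subgroup.mem_subgroupOf.mpr hy, e.apply_symm_apply y⟩
  have hN'n : N'.Normal := hNn.map e.toMonoidHom e.surjective
  have hN'c : IsClosed (N' : Set (absoluteGaloisGroup E)) := by
    have h1 : (N' : Set (absoluteGaloisGroup E)) = e '' ((N.subgroupOf H : Subgroup H) : Set H) :=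
      Subgroup.coe_map _ _
    rw [h1]
    refine e.toHomeomorph.isClosedMap _ ?_
    change IsClosed (((↑) : H → absoluteGaloisGroup F) ⁻¹' (N : Set (absoluteGaloisGroup F)))
    exact hNc.preimage continuous_subtype_val
  -- `N ≅ N'` topologically, so `N'` is topologically finitely generated
  have hmemf : ∀ x : N, e ⟨x, hNH x.2⟩ ∈ N' := fun x =>
    ⟨⟨x, hNH x.2⟩, Subgroup.mem_subgroupOf.mpr x.2, rfl⟩
  let f : N →ₜ* N' :=
    { toFun := fun x => ⟨e ⟨x, hNH x.2⟩, hmemf x⟩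
      map_one' := Subtype.ext (by
        change e ⟨((1 : N) : absoluteGaloisGroup F), _⟩ = 1
        rw [← map_one e]; rfl)
      map_mul' := fun a b => Subtype.ext (by
        change e ⟨((a * b : N) : absoluteGaloisGroup F), _⟩ = e _ * e _
        rw [← map_mul]; rfl)
      continuous_toFun :=
        (e.continuous.comp (continuous_subtype_val.subtype_mk _)).subtype_mk _ }
  have hf : Function.Surjective f := by
    rintro ⟨y, hy⟩
    refine ⟨⟨((e.symm y : H) : absoluteGaloisGroup F), (hmemN' y).mp hy⟩, Subtype.ext ?_⟩
    change e ⟨((e.symm y : H) : absoluteGaloisGroup F), _⟩ = y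
    rw [Subtype.coe_eta, e.apply_symm_apply]
  have hN'fg : IsTopologicallyFinitelyGenerated N' :=
    IsTopologicallyFinitelyGenerated.of_surjective f hf hNfg
  -- [AbsAnab] Thm 1.1.2 for the number field `E`
  have hbot : N' = ⊥ :=
    galoisNF_tfgNormalSubgroup_trivial_holds E N' hN'n hN'c hN'fg.exists_finset
  -- pull back
  rw [eq_bot_iff]
  intro x hx
  have hx' : e ⟨x, hNH hx⟩ ∈ N' := hmemf ⟨x, hx⟩
  rw [hbot, Subgroup.mem_bot, map_eq_one_iff e e.injective] at hx'
  exact Subgroup.mem_bot.mpr (congrArg Subtype.val hx')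

/-- **[AbsTopI] Thm 1.7 (iii), elasticity**: the absolute Galois group of a number field is elastic.
[cite: MochizukiAbsTopI2012, Thm 1.7 (iii) p.14] -/
theorem isElastic_absoluteGaloisGroup_numberField (F : Type) [Field F] [NumberField F] :
    IsElastic (absoluteGaloisGroup F) :=
  ⟨fun H N hHo hNH hNn hNc hNfg => Or.inl
    (eq_bot_of_tfg_normal_of_isOpen_absoluteGaloisGroup_numberField F H N hHo hNH hNn hNc hNfg)⟩

/-- **[AbsTopI] Thm 1.7 (iii), "very elastic"**: `G_F` (number field `F`) is elastic and not
topologically finitely generated. [cite: MochizukiAbsTopI2012, Thm 1.7 (iii) p.14] -/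
theorem isVeryElastic_absoluteGaloisGroup_numberField (F : Type) [Field F] [NumberField F] :
    IsVeryElastic (absoluteGaloisGroup F) :=
  ⟨isElastic_absoluteGaloisGroup_numberField F, not_isTopologicallyFinitelyGenerated_absoluteGaloisGroup F⟩

/-- **[AbsTopI] Thm 1.7 (iii)** (case `k̃ = k̄`): "If `k` is an NF, then `G_k` is very elastic and
slim." — very elastic by `isVeryElastic_absoluteGaloisGroup_numberField`, slim by [AbsAnab]
Thm 1.1.1 (ii) (`galoisNF_slim_holds`). [cite: MochizukiAbsTopI2012, Thm 1.7 (iii) p.14] -/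
theorem thm17iii (F : Type) [Field F] [NumberField F] :
    IsVeryElastic (absoluteGaloisGroup F) ∧ IsSlimGroup (absoluteGaloisGroup F) :=
  ⟨isVeryElastic_absoluteGaloisGroup_numberField F, galoisNF_slim_holds F⟩

/-- **[AbsTopI] Thm 1.7 (ii)** (case `k̃ = k̄`, the group `G_k` itself): "If `k` is an MLF [...],
then `G_k` [...] is elastic and slim" — elastic by `isElastic_absoluteGaloisGroup` (the cell's rank
route, GAP row G-w5d206-1), slim by [AbsAnab] Thm 1.1.1 (ii) (`galoisMLF_slim_holds`).  The clause
on almost pro-`p`-maximal quotients is NOT addressed. [cite: MochizukiAbsTopI2012, Thm 1.7 (ii) p.14] -/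
theorem thm17ii (p : ℕ) [Fact p.Prime] (K : Type) [Field K] [Algebra ℚ_[p] K]
    [FiniteDimensional ℚ_[p] K] :
    IsElastic (absoluteGaloisGroup K) ∧ IsSlimGroup (absoluteGaloisGroup K) :=
  ⟨isElastic_absoluteGaloisGroup p K, galoisMLF_slim_holds p K⟩

end Literature.AnabelianGeometry.AbsoluteAnabelian

end
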